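import Summits.HodgeConjecture.CorCM.IrreducibleOddWeightsCanonicalPivotGaloisModel
import Summits.HodgeConjecture.CorCM.IrreducibleOddWeightsCanonicalPivotTraceCount
import HarnessLib

/-!
# Canonical pivot, XIII: THE TRACE ON THE GALOIS MODEL — on `Aut(L)` the orbits of the automorphisms fixing every
# embedding of `K₁` are the classes of `Hom(K₀, L)` agreeing on the trace `x₀⁻¹(L₁)`, the trace in `L` is the trace in
# `ℂ`, and the classes are counted by `[x₀(K₀) ∩ L₁ : ℚ]`

COR-CM (cell `pub-hodgecm2`, binder seat `b16` gen 66, count-neutral claim TRACE COUNT, file T3 — CM fields on a finite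
Galois model; theorems only, no definition, no named fact, no `sorry`).  NEW as stated, hence under `Summits/`.  HONEST
FRAMING: book-keeping statements that let the census seats run gen 65's finite defect formula (C10) with TRACE CLASSES
instead of stabiliser orbits; nothing is claimed about Hodge classes; `HC_CM` is neither used nor asserted.  Closes
honest-open item (ii) of the gen-65 card CANONICAL-PIVOT («the trace description of the orbits on the Galois model is not
filed»).

SETTING (C10).  Number fields `K_i`, a NORMAL number field `L` receiving them (`e_i : K_i → L`), `ι : L → ℂ`;
`L₁ᴸ = normalClosure ℚ K_{i₁} L` (the compositum of the images of all `y : K_{i₁} → L`) and `L₁ = normalClosure ℚ K_{i₁} ℂ`.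

* §1 **`map_normalClosure_eq`**: `ι(L₁ᴸ) = L₁`; **`mem_normalClosure_iff_apply_mem`**: `z ∈ L₁ᴸ ↔ ι z ∈ L₁`;
  **`forall_galSmul_eq_iff_forall_mem_normalClosure`**: an automorphism of `L` fixes every embedding `K_{i₁} → L` iff it
  fixes `L₁ᴸ` pointwise.
* §2 **`exists_galStab_smul_eq_iff_forall_apply_eq`** — THE TRACE DESCRIPTION ON THE MODEL: for `x₀, x : K_{i₀} → L`,
  `x ∈ Aut(L/L₁ᴸ)·x₀ ↔ x = x₀ on x₀⁻¹(L₁ᴸ)` (transported from C2's `Aut(ℂ)` statement along `ι`: automorphisms of `L`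
  extend to `ℂ`, automorphisms of `ℂ` restrict to the normal field `ι(L)`); hence the finite defect formula of C10 with
  trace classes, **`cmTypeRank_add_cmTypeRank_eq_cmFamilyRank_add_one_add_finrank_galTraceSum_inf`**:
  `dim Hg(A₀) + dim Hg(A₁) − dim Hg(A₀ × A₁) = dim(F₀ ∩ F₁)` in `ℚ^{Aut(L)}` with
  `F₀ = span{ g ↦ Σ_{x = x₀ on x₀⁻¹(L₁ᴸ)} u(Φ₀ᴸ)(g·x) : x₀ }`.
* §3 **`card_galTraceClasses_eq_finrank`**: the number of trace classes of `Hom(K_{i₀}, L)` is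
  `[x₀(K_{i₀}) ∩ L₁ᴸ : ℚ]` (computed inside `L`; = `[(ι∘x₀)(K_{i₀}) ∩ L₁ : ℚ]`, T1) — so on the model, too, the numeric
  trace bound of T2 reads off one intermediate field of `L`.

## References

* [Shimura1998] G. Shimura, *Abelian Varieties with Complex Multiplication and Modular Functions*, §8.1, §32.7.
* [Lang2002] S. Lang, *Algebra*, GTM 211, V §2 Thm. 2.8, VI §1 Thm. 1.1, Cor. 1.6, Thm. 1.12.
* [Gordon1999HodgeAVSurvey] B. B. Gordon, *A survey of the Hodge conjecture for abelian varieties*, §3 Theorem (proof),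
  7.5–7.7.
-/

set_option autoImplicit false

noncomputable section

open scoped BigOperators Classical

open NumberField Module IntermediateField

namespace Summit.HodgeConjecture.CorCM

open Literature.NumberTheory.ComplexMultiplication
open Literature.AlgebraicGeometry.Motives (CMType)
open Literature.AlgebraicGeometry.Pohlmann1968

/-! ### §1 The Galois closure inside `L` and inside `ℂ` -/

section Closure

variable {I : Type} {K : I → Type} [∀ i, Field (K i)] [∀ i, NumberField (K i)]
  {L : Type} [Field L] [NumberField L]

/-- **`ι` maps the Galois closure of `K_{i₁}` in `L` ONTO its Galois closure in `ℂ`** (`L` normal receiving `K_{i₁}`: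
every complex embedding of `K_{i₁}` is `ι ∘ y`). [cite: Lang2002, V §2 Thm. 2.8] [cite: Shimura1998, §8.1] -/
theorem map_normalClosure_eq [Normal ℚ L] (ι : L →+* ℂ) (e : ∀ i, K i →+* L) (i₁ : I) :
    (normalClosure ℚ (K i₁) L).map ι.toRatAlgHom = normalClosure ℚ (K i₁) ℂ := by
  refine le_antisymm ?_ ?_
  · rw [IntermediateField.map_le_iff_le_comap]
    refine normalClosure_le_iff.2 fun f => ?_
    rintro _ ⟨y, rfl⟩
    change ι.toRatAlgHom (f y) ∈ normalClosure ℚ (K i₁) ℂ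
    exact (ι.toRatAlgHom.comp f).fieldRange_le_normalClosure ⟨y, rfl⟩
  · refine normalClosure_le_iff.2 fun F => ?_
    rintro _ ⟨y, rfl⟩
    obtain ⟨f, hf⟩ := (comp_bijective ι e i₁).2 (F : K i₁ →+* ℂ)
    refine (IntermediateField.mem_map _).2 ⟨f y, f.toRatAlgHom.fieldRange_le_normalClosure ⟨y, rfl⟩, ?_⟩
    change ι (f y) = (F : K i₁ →+* ℂ) y
    rw [← hf, RingHom.comp_apply]

/-- `z ∈ L₁ᴸ ↔ ι z ∈ L₁`. [cite: Lang2002, V §2 Thm. 2.8] -/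
theorem mem_normalClosure_iff_apply_mem [Normal ℚ L] (ι : L →+* ℂ) (e : ∀ i, K i →+* L) (i₁ : I) (z : L) :
    z ∈ normalClosure ℚ (K i₁) L ↔ ι z ∈ normalClosure ℚ (K i₁) ℂ := by
  rw [← map_normalClosure_eq ι e i₁]
  exact (IntermediateField.map_mem_map _ ι.toRatAlgHom).symm

/-- An automorphism fixing `L₁ᴸ` pointwise fixes every embedding `K_{i₁} → L`. [cite: Shimura1998, §8.1] -/
theorem galSmul_eq_of_forall_mem_normalClosure (i₁ : I) (n : L ≃+* L)
    (h : ∀ z : L, z ∈ normalClosure ℚ (K i₁) L → n z = z) (y : K i₁ →+* L) : n • y = y :=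
  RingHom.ext fun k => by
    rw [ringEquiv_smul_apply]
    exact h _ (y.toRatAlgHom.fieldRange_le_normalClosure ⟨k, rfl⟩)

/-- **`Aut(L/L₁ᴸ)` = the automorphisms of `L` fixing every embedding `K_{i₁} → L`.** [cite: Shimura1998, §8.1]
[cite: Lang2002, V §2 Thm. 2.8] -/
theorem forall_galSmul_eq_iff_forall_mem_normalClosure [Normal ℚ L] (ι : L →+* ℂ) (e : ∀ i, K i →+* L) (i₁ : I)
    (n : L ≃+* L) :
    (∀ y : K i₁ →+* L, n • y = y) ↔ ∀ z : L, z ∈ normalClosure ℚ (K i₁) L → n z = z := by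
  refine ⟨fun h z hz => ?_, galSmul_eq_of_forall_mem_normalClosure i₁ n⟩
  -- extend `n` to `τ ∈ Aut(ℂ)`; `τ` fixes every complex embedding of `K_{i₁}`, hence `L₁` pointwise
  obtain ⟨τ, hτ⟩ := exists_ringEquiv_complex_apply_eq ι n
  have hfix : ∀ Y : K i₁ →+* ℂ, τ • Y = Y := fun Y => by
    obtain ⟨y, rfl⟩ := (comp_bijective ι e i₁).2 Y
    refine RingHom.ext fun k => ?_
    rw [ringEquiv_smul_apply, RingHom.comp_apply, hτ, ← ringEquiv_smul_apply n y k, h y]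
  have h1 := (forall_smul_eq_iff_forall_mem_normalClosure i₁ τ).1 hfix (ι z)
    ((mem_normalClosure_iff_apply_mem ι e i₁ z).1 hz)
  rw [hτ] at h1
  exact ι.injective h1

end Closure

/-! ### §2 The trace description of the orbits on the model -/

section Orbits

variable {I : Type} {K : I → Type} [∀ i, Field (K i)] [∀ i, NumberField (K i)]
  {L : Type} [Field L] [NumberField L]

/-- **THE TRACE DESCRIPTION ON THE GALOIS MODEL**: for `x₀, x : K_{i₀} → L` (`L` normal receiving the `K_i`),
`x = n ∘ x₀` for an automorphism `n` of `L` fixing every embedding of `K_{i₁}` **iff `x` and `x₀` agree on the trace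
`x₀⁻¹(L₁ᴸ)`** — C2's statement on `Aut(ℂ)` transported along `ι`. [cite: Lang2002, VI §1 Thm. 1.1, Cor. 1.6 and V §2 Thm. 2.8]
[cite: Shimura1998, §8.1] -/
theorem exists_galStab_smul_eq_iff_forall_apply_eq [Normal ℚ L] (ι : L →+* ℂ) (e : ∀ i, K i →+* L) {i₀ : I}
    (i₁ : I) (x₀ x : K i₀ →+* L) :
    (∃ n : L ≃+* L, (∀ y : K i₁ →+* L, n • y = y) ∧ n • x₀ = x) ↔
      ∀ k : K i₀, x₀ k ∈ normalClosure ℚ (K i₁) L → x k = x₀ k := by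
  constructor
  · rintro ⟨n, hn, rfl⟩ k hk
    rw [ringEquiv_smul_apply]
    exact (forall_galSmul_eq_iff_forall_mem_normalClosure ι e i₁ n).1 hn _ hk
  · intro h
    -- on `Aut(ℂ)`: `ι ∘ x` agrees with `ι ∘ x₀` on the trace, so `ι ∘ x = N ∘ ι ∘ x₀` with `N ∈ Aut(ℂ/L₁)`
    have hC : ∀ k : K i₀, (ι.comp x₀) k ∈ normalClosure ℚ (K i₁) ℂ → (ι.comp x) k = (ι.comp x₀) k := by
      intro k hk
      rw [RingHom.comp_apply, RingHom.comp_apply, h k ((mem_normalClosure_iff_apply_mem ι e i₁ _).2 hk)]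
    obtain ⟨N, hN, hNx⟩ := (exists_stab_smul_eq_iff_forall_apply_eq i₁ (ι.comp x₀) (ι.comp x)).2 hC
    -- restrict `N` to `γ ∈ Aut(L)`
    obtain ⟨γ, hγ⟩ := exists_algEquiv_comp_eq_smul ι N
    refine ⟨(γ : L ≃+* L), fun y => RingHom.ext fun k => ι.injective ?_, RingHom.ext fun k => ι.injective ?_⟩
    · rw [ringEquiv_smul_apply, AlgEquiv.coe_ringEquiv, ← hγ, ← RingHom.comp_apply ι y k,
        ← ringEquiv_smul_apply N (ι.comp y) k, hN]
    · rw [ringEquiv_smul_apply, AlgEquiv.coe_ringEquiv, ← hγ, ← RingHom.comp_apply ι x₀ k,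
        ← ringEquiv_smul_apply N (ι.comp x₀) k, hNx, RingHom.comp_apply]

/-- The orbit of `x₀` under `Aut(L/L₁ᴸ)`, as a finite set, is the trace class of `x₀`.
[cite: Lang2002, VI §1 Thm. 1.1 and Cor. 1.6] -/
theorem filter_exists_galStab_smul_eq_eq_filter_trace [Normal ℚ L] (ι : L →+* ℂ) (e : ∀ i, K i →+* L) {i₀ : I}
    (i₁ : I) (x₀ : K i₀ →+* L) :
    Finset.univ.filter (fun x : K i₀ →+* L => ∃ n : L ≃+* L, (∀ y : K i₁ →+* L, n • y = y) ∧ n • x₀ = x) =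
      Finset.univ.filter (fun x : K i₀ →+* L => ∀ k : K i₀, x₀ k ∈ normalClosure ℚ (K i₁) L → x k = x₀ k) :=
  Finset.filter_congr fun x _ => exists_galStab_smul_eq_iff_forall_apply_eq ι e i₁ x₀ x

omit [NumberField L] in
/-- The orbit sums over `Aut(L/L₁ᴸ)` are the sums over the trace classes (function form, for rewriting under binders).
[cite: Lang2002, VI §1 Thm. 1.1 and Cor. 1.6] -/
theorem galStabOrbitSum_eq_galTraceSum [NumberField L] [Normal ℚ L] (ι : L →+* ℂ) (e : ∀ i, K i →+* L) {i₀ : I}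
    (i₁ : I) (Ψ : Set (K i₀ →+* L)) :
    (fun x₀ : K i₀ →+* L => fun g : L ≃+* L =>
        ∑ x ∈ Finset.univ.filter
          (fun x : K i₀ →+* L => ∃ n : L ≃+* L, (∀ y : K i₁ →+* L, n • y = y) ∧ n • x₀ = x), antiVec Ψ g x) =
      fun x₀ : K i₀ →+* L => fun g : L ≃+* L =>
        ∑ x ∈ Finset.univ.filter
          (fun x : K i₀ →+* L => ∀ k : K i₀, x₀ k ∈ normalClosure ℚ (K i₁) L → x k = x₀ k), antiVec Ψ g x := by
  funext x₀ g
  rw [filter_exists_galStab_smul_eq_eq_filter_trace ι e i₁ x₀]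

end Orbits

/-! ### §3 The finite defect formula with trace classes, and their number -/

section Defect

variable {I : Type} [Fintype I] {K : I → Type} [∀ i, Field (K i)] [∀ i, NumberField (K i)]
  {L : Type} [Field L] [NumberField L] [IsCMField L] [Normal ℚ L]

/-- **THE EXACT DEFECT ON THE GALOIS MODEL WITH TRACE CLASSES.**  `L` a normal CM number field receiving `K_{i₀}`,
`K_{i₁}` (`e`), `ι : L → ℂ`: **`cmTypeRank Φ₀ + cmTypeRank Φ₁ = cmFamilyRank Φ + 1 + dim(F₀ ∩ F₁)`** in `ℚ^{Aut(L)}`,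
`F₀ = span{ g ↦ Σ_{x = x₀ on x₀⁻¹(L₁ᴸ)} u(Φ₀ᴸ)(g·x) : x₀ ∈ Hom(K_{i₀}, L) }` — the classes of embeddings into `L`
agreeing on the trace of `L₁ᴸ = normalClosure ℚ K_{i₁} L` — and `F₁` symmetrically (C10's formula, orbits rewritten by
§2). [cite: Shimura1998, §32.7 and §8.1] [cite: Gordon1999HodgeAVSurvey, §3 Theorem and 7.5–7.7] -/
theorem cmTypeRank_add_cmTypeRank_eq_cmFamilyRank_add_one_add_finrank_galTraceSum_inf (ι : L →+* ℂ)
    (e : ∀ i, K i →+* L) {i₀ i₁ : I} (h01 : i₀ ≠ i₁) (hI : ∀ l, l = i₀ ∨ l = i₁) (Φ : ∀ i, CMType (K i)) :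
    cmTypeRank (Φ i₀) + cmTypeRank (Φ i₁) = CMAlgebra.cmFamilyRank Φ + 1 +
      Module.finrank ℚ (Submodule.span ℚ (Set.range fun x₀ : K i₀ →+* L => fun g : L ≃+* L =>
            ∑ x ∈ Finset.univ.filter
              (fun x : K i₀ →+* L => ∀ k : K i₀, x₀ k ∈ normalClosure ℚ (K i₁) L → x k = x₀ k),
                antiVec {x : K i₀ →+* L | ι.comp x ∈ (Φ i₀).1} g x) ⊓
          Submodule.span ℚ (Set.range fun x₁ : K i₁ →+* L => fun g : L ≃+* L =>
            ∑ x ∈ Finset.univ.filter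
              (fun x : K i₁ →+* L => ∀ k : K i₁, x₁ k ∈ normalClosure ℚ (K i₀) L → x k = x₁ k),
                antiVec {x : K i₁ →+* L | ι.comp x ∈ (Φ i₁).1} g x) : Submodule ℚ ((L ≃+* L) → ℚ)) := by
  have h := cmTypeRank_add_cmTypeRank_eq_cmFamilyRank_add_one_add_finrank_galStabOrbitSum_inf ι e h01 hI Φ
  rw [galStabOrbitSum_eq_galTraceSum ι e i₁ {x : K i₀ →+* L | ι.comp x ∈ (Φ i₀).1},
    galStabOrbitSum_eq_galTraceSum ι e i₀ {x : K i₁ →+* L | ι.comp x ∈ (Φ i₁).1}] at h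
  exact h

/-- **`Hg(A₀ × A₁) = Hg(A₀) × Hg(A₁)` iff the trace-class sums on the model span subspaces meeting in `0`.**
[cite: Shimura1998, §32.7] [cite: Gordon1999HodgeAVSurvey, §3 Theorem and 7.5–7.7] -/
theorem cmFamilyRank_add_card_eq_pair_iff_galTraceSum_inf_eq_bot (ι : L →+* ℂ) (e : ∀ i, K i →+* L) {i₀ i₁ : I}
    (h01 : i₀ ≠ i₁) (hI : ∀ l, l = i₀ ∨ l = i₁) (Φ : ∀ i, CMType (K i)) :
    CMAlgebra.cmFamilyRank Φ + Fintype.card I = (∑ i, cmTypeRank (Φ i)) + 1 ↔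
      Submodule.span ℚ (Set.range fun x₀ : K i₀ →+* L => fun g : L ≃+* L =>
            ∑ x ∈ Finset.univ.filter
              (fun x : K i₀ →+* L => ∀ k : K i₀, x₀ k ∈ normalClosure ℚ (K i₁) L → x k = x₀ k),
                antiVec {x : K i₀ →+* L | ι.comp x ∈ (Φ i₀).1} g x) ⊓
          Submodule.span ℚ (Set.range fun x₁ : K i₁ →+* L => fun g : L ≃+* L =>
            ∑ x ∈ Finset.univ.filter
              (fun x : K i₁ →+* L => ∀ k : K i₁, x₁ k ∈ normalClosure ℚ (K i₀) L → x k = x₁ k),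
                antiVec {x : K i₁ →+* L | ι.comp x ∈ (Φ i₁).1} g x) = (⊥ : Submodule ℚ ((L ≃+* L) → ℚ)) := by
  have h := cmFamilyRank_add_card_eq_pair_iff_galStabOrbitSum_inf_eq_bot ι e h01 hI Φ
  rw [galStabOrbitSum_eq_galTraceSum ι e i₁ {x : K i₀ →+* L | ι.comp x ∈ (Φ i₀).1},
    galStabOrbitSum_eq_galTraceSum ι e i₀ {x : K i₁ →+* L | ι.comp x ∈ (Φ i₁).1}] at h
  exact h

omit [Fintype I] [IsCMField L] in
/-- **THE NUMBER OF TRACE CLASSES ON THE MODEL is `[(ι ∘ x₀)(K_{i₀}) ∩ L₁ : ℚ]`**: composition with `ι` is a bijection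
`Hom(K_{i₀}, L) → Hom(K_{i₀}, ℂ)` carrying the trace class of `x₀` onto the trace class of `ι ∘ x₀` (§1), and T1 counts
the latter. [cite: Lang2002, VI §1 Thm. 1.1, Cor. 1.6 and Thm. 1.12] [cite: Shimura1998, §8.1] -/
theorem card_galTraceClasses_eq_finrank (ι : L →+* ℂ) (e : ∀ i, K i →+* L) {i₀ : I} (i₁ : I) (x₀ : K i₀ →+* L) :
    (Finset.univ.image fun a : K i₀ →+* L =>
        Finset.univ.filter (fun x : K i₀ →+* L => ∀ k : K i₀, a k ∈ normalClosure ℚ (K i₁) L → x k = a k)).card =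
      finrank ℚ ↥((ι.comp x₀).toRatAlgHom.fieldRange ⊓ normalClosure ℚ (K i₁) ℂ) := by
  let c : (K i₀ →+* L) → (K i₀ →+* ℂ) := fun x => ι.comp x
  have hc : Function.Bijective c := comp_bijective ι e i₀
  have hcinj : Function.Injective c := hc.1
  -- the class of `a` is carried onto the class of `ι ∘ a`
  have hclass : ∀ a : K i₀ →+* L,
      (Finset.univ.filter (fun x : K i₀ →+* L =>
          ∀ k : K i₀, a k ∈ normalClosure ℚ (K i₁) L → x k = a k)).image c =
        Finset.univ.filter (fun t : K i₀ →+* ℂ =>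
          ∀ k : K i₀, (c a) k ∈ normalClosure ℚ (K i₁) ℂ → t k = (c a) k) := by
    intro a
    ext t
    simp only [Finset.mem_image, Finset.mem_filter, Finset.mem_univ, true_and]
    constructor
    · rintro ⟨x, hx, rfl⟩ k hk
      change ι (x k) = ι (a k)
      rw [hx k ((mem_normalClosure_iff_apply_mem ι e i₁ _).2 hk)]
    · intro ht
      obtain ⟨x, rfl⟩ := hc.2 t
      refine ⟨x, fun k hk => ι.injective ?_, rfl⟩
      exact ht k ((mem_normalClosure_iff_apply_mem ι e i₁ _).1 hk)
  -- hence the set of classes is carried bijectively onto the set of classes in `ℂ`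
  have himage : (Finset.univ.image fun a : K i₀ →+* L =>
        Finset.univ.filter (fun x : K i₀ →+* L => ∀ k : K i₀, a k ∈ normalClosure ℚ (K i₁) L → x k = a k)).image
          (fun C => C.image c) =
      Finset.univ.image fun a : K i₀ →+* ℂ =>
        Finset.univ.filter (fun t : K i₀ →+* ℂ => ∀ k : K i₀, a k ∈ normalClosure ℚ (K i₁) ℂ → t k = a k) := by
    have hcomp : ((fun C : Finset (K i₀ →+* L) => C.image c) ∘ fun a : K i₀ →+* L =>
          Finset.univ.filter (fun x : K i₀ →+* L => ∀ k : K i₀, a k ∈ normalClosure ℚ (K i₁) L → x k = a k)) =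
        (fun a : K i₀ →+* ℂ => Finset.univ.filter (fun t : K i₀ →+* ℂ =>
          ∀ k : K i₀, a k ∈ normalClosure ℚ (K i₁) ℂ → t k = a k)) ∘ c :=
      funext fun a => hclass a
    rw [Finset.image_image, hcomp, ← Finset.image_image, Finset.image_univ_of_surjective hc.2]
  rw [← Finset.card_image_of_injective _ (Finset.image_injective hcinj), himage,
    card_traceClasses_eq_finrank i₁ (c x₀)]

omit [Fintype I] [IsCMField L] in
/-- … computed INSIDE `L`: `[(ι ∘ x₀)(K_{i₀}) ∩ L₁ : ℚ] = [x₀(K_{i₀}) ∩ L₁ᴸ : ℚ]` (`ι` restricts to an isomorphism of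
the two intermediate fields). [cite: Lang2002, VI §1 Thm. 1.12] -/
theorem finrank_fieldRange_inf_normalClosure_eq_model (ι : L →+* ℂ) (e : ∀ i, K i →+* L) {i₀ : I} (i₁ : I)
    (x₀ : K i₀ →+* L) :
    finrank ℚ ↥((ι.comp x₀).toRatAlgHom.fieldRange ⊓ normalClosure ℚ (K i₁) ℂ) =
      finrank ℚ ↥(x₀.toRatAlgHom.fieldRange ⊓ normalClosure ℚ (K i₁) L) := by
  have hmap : (x₀.toRatAlgHom.fieldRange ⊓ normalClosure ℚ (K i₁) L).map ι.toRatAlgHom =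
      (ι.comp x₀).toRatAlgHom.fieldRange ⊓ normalClosure ℚ (K i₁) ℂ := by
    rw [IntermediateField.map_inf, map_normalClosure_eq ι e i₁]
    congr 1
    refine le_antisymm ?_ ?_
    · rintro _ ⟨z, hz, rfl⟩
      obtain ⟨k, rfl⟩ := AlgHom.mem_fieldRange.1 hz
      exact AlgHom.mem_fieldRange.2 ⟨k, rfl⟩
    · rintro _ ⟨k, rfl⟩
      exact (IntermediateField.mem_map _).2 ⟨x₀ k, AlgHom.mem_fieldRange.2 ⟨k, rfl⟩, rfl⟩
  rw [← (IntermediateField.equivOfEq hmap).toLinearEquiv.finrank_eq]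
  exact ((IntermediateField.equivMap (x₀.toRatAlgHom.fieldRange ⊓ normalClosure ℚ (K i₁) L)
    ι.toRatAlgHom).toLinearEquiv.finrank_eq).symm

omit [Fintype I] [IsCMField L] in
/-- **`#trace classes of Hom(K_{i₀}, L) = [x₀(K_{i₀}) ∩ L₁ᴸ : ℚ]`**, an intermediate field of the model `L`.
[cite: Lang2002, VI §1 Thm. 1.1, Cor. 1.6 and Thm. 1.12] -/
theorem card_galTraceClasses_eq_finrank_model (ι : L →+* ℂ) (e : ∀ i, K i →+* L) {i₀ : I} (i₁ : I)
    (x₀ : K i₀ →+* L) :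
    (Finset.univ.image fun a : K i₀ →+* L =>
        Finset.univ.filter (fun x : K i₀ →+* L => ∀ k : K i₀, a k ∈ normalClosure ℚ (K i₁) L → x k = a k)).card =
      finrank ℚ ↥(x₀.toRatAlgHom.fieldRange ⊓ normalClosure ℚ (K i₁) L) := by
  rw [card_galTraceClasses_eq_finrank ι e i₁ x₀, finrank_fieldRange_inf_normalClosure_eq_model ι e i₁ x₀]

end Defect

end Summit.HodgeConjecture.CorCM

end
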